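import Summits.QuantumFields.BalabanUV.Beta.DeGiorgiIteration

/-!
# Beta / SubsolutionMeanValueBox — THE ℓ² MEAN-VALUE INEQUALITY FOR NONNEGATIVE SUB-SOLUTIONS OF THE FREE LATTICE LAPLACIAN ON A
# TORUS BOX, IN THE KERNEL: `z(x₀) ≤ C_d·√(R^{−d}·Σ_{dist ≤ R} z²)` — the binder (MV) of E-an4-141a ∕ `SubsolutionMeanValue` §2 with a
# LEVEL-FREE constant, and the resulting `hreg`-SHAPE for the bare covariant Laplacian `D*D` (MODEL; unit torus `UT N`, constant
# bond weight; END of the chain «LATTICE-DEGIORGI-MV»)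

WHAT IS CERTIFIED (kernel, 0 sorry).  On the unit torus `UT N` with bonds `bsrc∕btgt`, a CONSTANT bond weight `c ≡ c₀ ≠ 0`, `d ≥ 1`,
a centre `x₀` and a radius `R ≥ 1` with `10R + 4 ≤ N_i`:
* **`meanValue_ball`** — every `z ≥ 0` with `W·z ≤ Nz` on the ball `dist(·, x₀) ≤ R` (the W∕N shape of files 12∕14∕P3) satisfies
  **`z(x₀) ≤ C_d·√((Σ_{dist ≤ R} z²)/R^d)`**, `C_d = 2^d/√θ_d` (`DeGiorgiIteration.theta`), a constant depending on `d` ONLY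
  (proof: `R = 1` trivially; else the dyadic depth `m = log₂R − 1`, `k = √(U₀/(θ_d 2^{md}))`, `DeGiorgiIteration.le_of_iteration` gives
  `z(x₀) ≤ k`, and `R < 2^{m+2}` gives `k ≤ C_d√(U₀/R^d)`);
* **`fibreNorm_le_box`** — `hreg`'s SHAPE for `D*D` with ANY column-orthonormal bond matrices `Rm`: if `√(Σ_i ((D*Df)(x,i))²) ≤ m′` on the
  ball, then `√(Σ_i f(x₀,i)²) ≤ C_d·√((Σ_{dist ≤ R} Σ_i f(x,i)²)/R^d) + m′·(R+1)²/(2c₀²)` — road P3's `SubsolutionMeanValue.fibreNorm_le_meanValue`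
  (Kato + order bookkeeping) with the owner's unit supersolution `TorusBoxSupersolution.exists_unit_supersolution_box` and THIS module's
  binder; NO hypothesis left: for the MODEL's bare covariant Laplacian on the torus, O.2 item (ii-b) is a THEOREM.
(unit `b2b-balaban-beta-d4-p2`, GEN 10, MODEL crew; claim «LATTICE-DEGIORGI-MV» journal l.22396.)

HONEST FRAMING: discharging `BetaPertH` makes Bałaban's UV stability UNCONDITIONAL — NOT the continuum limit, NOT the
Clay problem.  HONEST DEPENDENCY (verbatim): «continuum YM on T⁴ ⇐ BetaPertH ∧ nine spine estimates (0/9 proved);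
BetaPertH ⇐ (D1) ∧ (D4) ∧ CAP+tail; G-an2-4 gates asym, D1 and NE2/3/4.»  THIS MODULE DISCHARGES NOTHING of `BetaPertH`,
asserts NOTHING printed and cites nothing as a fact (ABSOLUTE RULE): [folklore] finite lattice calculus; CONSTANT weights only (the
covariant∕variable part enters through Kato, file 12); the multi-region operator's `hreg` (file 9b: `levelOp`, scale-adapted balls, the
averaging budget (P)) is the owner's assembly, not claimed here; print's own device for the same member is [B4] Lemma 2.2's (p,q)-chain —
NOT reproduced.  LOCATORS (shape only): [Balaban1985BackgroundPropagators] Thm 3.1 (3.42) p. 397, (3.23) p. 394.  No class change on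
row D4 (critical-path width 0; D4 DISCHARGE NO DATE); NOT BetaPertH, NOT continuum, NOT Clay, NOT summit progress.
-/

open scoped BigOperators
open Finset

namespace Summit.QuantumFields.BalabanUV.Beta.SubsolutionMeanValueBox

open Literature.MathematicalPhysics.QuantumFieldTheory.Balaban1983to89
open Literature.MathematicalPhysics.QuantumFieldTheory.Balaban1983to89.B9Thm37Glue (covD covDT)
open Literature.MathematicalPhysics.QuantumFieldTheory.Balaban1983to89.B9Thm37GluePU (bsrc btgt)
open B5TorusCover (UT)
open Summit.QuantumFields.BalabanUV.Beta.DeGiorgiIteration (theta theta_pos theta_lt Useq Useq_zero le_of_iteration centre_mem)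
open Summit.QuantumFields.BalabanUV.Beta.SubsolutionMeanValue (fibreNorm_le_meanValue)
open Summit.QuantumFields.BalabanUV.Beta.TorusBoxSupersolution (exists_unit_supersolution_box)

noncomputable section

variable {d : ℕ} {N : Fin d → ℕ} [∀ i, NeZero (N i)]

/-! ## §1 The constant -/

/-- **The mean-value constant** `C_d = 2^d/√θ_d` — depends on `d` only. [folklore] -/
def Cmv (d : ℕ) : ℝ := 2 ^ d / Real.sqrt (theta d)

omit [∀ i, NeZero (N i)] in
/-- `C_d > 0`. [folklore] -/
theorem Cmv_pos {d : ℕ} (hd : 1 ≤ d) : 0 < Cmv d := by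
  unfold Cmv; exact div_pos (by positivity) (Real.sqrt_pos.mpr (theta_pos hd))

omit [∀ i, NeZero (N i)] in
/-- `C_d ≥ 1` (`√θ_d < 1 ≤ 2^d`). [folklore] -/
theorem one_le_Cmv {d : ℕ} (hd : 1 ≤ d) : 1 ≤ Cmv d := by
  unfold Cmv
  have hθ := theta_lt hd
  have hθ0 := theta_pos hd
  have hs : Real.sqrt (theta d) ≤ 1 := by
    rw [Real.sqrt_le_left zero_le_one]; linarith
  have hs0 : 0 < Real.sqrt (theta d) := Real.sqrt_pos.mpr hθ0
  rw [le_div_iff₀ hs0, one_mul]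
  exact hs.trans (one_le_pow₀ (by norm_num))

omit [∀ i, NeZero (N i)] in
/-- `C_d² = 4^d/θ_d`. [folklore] -/
theorem Cmv_sq {d : ℕ} (hd : 1 ≤ d) : Cmv d ^ 2 = 4 ^ d / theta d := by
  unfold Cmv
  rw [div_pow, Real.sq_sqrt (theta_pos hd).le]
  congr 1
  rw [← pow_mul, mul_comm, pow_mul]
  norm_num

/-! ## §2 THE MEAN-VALUE INEQUALITY -/

/-- **THE ℓ² MEAN-VALUE INEQUALITY FOR NONNEGATIVE SUB-SOLUTIONS ON A TORUS BOX (free lattice Laplacian, constant weight).**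
`c ≡ c₀ ≠ 0`, `R ≥ 1`, `10R + 4 ≤ N_i`; every `z ≥ 0` with `W·z ≤ Nz` on `dist(·, x₀) ≤ R` satisfies
`z(x₀) ≤ C_d·√((Σ_{dist ≤ R} z²)/R^d)`. [folklore] -/
theorem meanValue_ball [NeZero d] {c : UT N × Fin d → ℝ} {c₀ : ℝ} (hc : ∀ b, c b = c₀) (hc₀ : c₀ ≠ 0) (x₀ : UT N) {R : ℕ}
    (hR : 1 ≤ R) (hN : ∀ i, 10 * R + 4 ≤ N i) (z : UT N → ℝ) (hz0 : ∀ y, 0 ≤ z y)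
    (hz : ∀ x ∈ univ.filter (fun x : UT N => dist x x₀ ≤ R),
      ((∑ b ∈ univ.filter (fun b : UT N × Fin d => btgt b = x), c b ^ 2) +
          ∑ b ∈ univ.filter (fun b : UT N × Fin d => bsrc b = x), c b ^ 2) * z x ≤
        ((∑ b ∈ univ.filter (fun b : UT N × Fin d => btgt b = x), c b ^ 2 * z (bsrc b)) +
          ∑ b ∈ univ.filter (fun b : UT N × Fin d => bsrc b = x), c b ^ 2 * z (btgt b))) :
    z x₀ ≤ Cmv d * Real.sqrt ((∑ x ∈ univ.filter (fun x : UT N => dist x x₀ ≤ R), z x ^ 2) / (R : ℝ) ^ d) := by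
  have hd1 : 1 ≤ d := Nat.one_le_iff_ne_zero.mpr (NeZero.ne d)
  set U0 : ℝ := ∑ x ∈ univ.filter (fun x : UT N => dist x x₀ ≤ R), z x ^ 2 with hU0
  have hU00 : 0 ≤ U0 := Finset.sum_nonneg fun _ _ => sq_nonneg _
  have hR0 : (0 : ℝ) < R := by exact_mod_cast hR
  have hC1 := one_le_Cmv hd1
  have hC0 := Cmv_pos hd1
  -- the trivial bound `z(x₀)² ≤ U₀`
  have hx0mem : x₀ ∈ univ.filter (fun x : UT N => dist x x₀ ≤ R) :=
    Finset.mem_filter.mpr ⟨Finset.mem_univ _, by rw [dist_self]; exact Nat.cast_nonneg _⟩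
  have hzU : z x₀ ^ 2 ≤ U0 := Finset.single_le_sum (f := fun x => z x ^ 2) (fun _ _ => sq_nonneg _) hx0mem
  have hz_sqrt : z x₀ ≤ Real.sqrt U0 := (Real.le_sqrt (hz0 x₀) hU00).mpr hzU
  by_cases hR1 : R = 1
  · subst hR1
    simp only [Nat.cast_one, one_pow, div_one]
    calc z x₀ ≤ Real.sqrt U0 := hz_sqrt
      _ = 1 * Real.sqrt U0 := (one_mul _).symm
      _ ≤ Cmv d * Real.sqrt U0 := mul_le_mul_of_nonneg_right hC1 (Real.sqrt_nonneg _)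
  -- `R ≥ 2`: dyadic depth `m` with `2^{m+1} ≤ R < 2^{m+2}`
  have hR2 : 2 ≤ R := by omega
  have hlog : 1 ≤ Nat.log 2 R := Nat.log_pos (by norm_num) hR2
  set m : ℕ := Nat.log 2 R - 1 with hmdef
  have hm1 : m + 1 = Nat.log 2 R := by omega
  have hm : 2 ^ (m + 1) ≤ R := by rw [hm1]; exact Nat.pow_log_le_self 2 (by omega)
  have hRlt : R < 2 ^ (m + 2) := by
    rw [show m + 2 = (Nat.log 2 R).succ by omega]; exact Nat.lt_pow_succ_log_self (by norm_num) R
  by_cases hU0z : U0 = 0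
  · -- `z ≡ 0` on the ball
    have hz00 : z x₀ = 0 := by
      have h1 : z x₀ ^ 2 ≤ 0 := by rw [← hU0z]; exact hzU
      nlinarith [hz0 x₀]
    rw [hz00]; positivity
  have hU0pos : 0 < U0 := lt_of_le_of_ne hU00 (Ne.symm hU0z)
  have hθ0 := theta_pos hd1
  set k : ℝ := Real.sqrt (U0 / (theta d * 2 ^ (m * d))) with hkdef
  have hk2 : k ^ 2 = U0 / (theta d * 2 ^ (m * d)) := Real.sq_sqrt (by positivity)
  have hk : 0 < k := Real.sqrt_pos.mpr (by positivity)
  have hkU : Useq z x₀ R m k 0 ≤ k ^ 2 * theta d * 2 ^ (m * d) := by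
    rw [Useq_zero z hz0 x₀ hm k, ← hU0, hk2]
    apply le_of_eq
    field_simp
  have hzk : z x₀ ≤ k := le_of_iteration hc hc₀ x₀ hm hN z hz hk hkU (centre_mem x₀ R m (m + 1))
  -- `k ≤ C_d·√(U₀/R^d)` since `R < 2^{m+2}`
  have hRM : (R : ℝ) ^ d ≤ 4 ^ d * 2 ^ (m * d) := by
    have h1 : (R : ℝ) ≤ 4 * 2 ^ m := by
      have : ((R : ℕ) : ℝ) < ((2 ^ (m + 2) : ℕ) : ℝ) := by exact_mod_cast hRlt
      have e : ((2 ^ (m + 2) : ℕ) : ℝ) = 4 * 2 ^ m := by push_cast; rw [pow_add]; ring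
      linarith
    calc (R : ℝ) ^ d ≤ (4 * 2 ^ m) ^ d := pow_le_pow_left₀ hR0.le h1 d
      _ = 4 ^ d * 2 ^ (m * d) := by rw [mul_pow, ← pow_mul]
  have hk_le : k ≤ Cmv d * Real.sqrt (U0 / (R : ℝ) ^ d) := by
    have hrhs : Cmv d * Real.sqrt (U0 / (R : ℝ) ^ d) = Real.sqrt (Cmv d ^ 2 * (U0 / (R : ℝ) ^ d)) := by
      rw [Real.sqrt_mul' _ (by positivity), Real.sqrt_sq hC0.le]
    rw [hrhs, hkdef]
    apply Real.sqrt_le_sqrt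
    rw [Cmv_sq hd1, div_mul_div_comm, div_le_div_iff₀ (by positivity) (by positivity)]
    calc U0 * (theta d * (R : ℝ) ^ d) ≤ U0 * (theta d * (4 ^ d * 2 ^ (m * d))) :=
          mul_le_mul_of_nonneg_left (mul_le_mul_of_nonneg_left hRM hθ0.le) hU00
      _ = 4 ^ d * U0 * (theta d * 2 ^ (m * d)) := by ring
  exact hzk.trans hk_le

/-! ## §3 `hreg`'s SHAPE for the bare covariant Laplacian on a torus box, hypothesis-free -/

omit [∀ i, NeZero (N i)] in
/-- The ℓ² mean-value functional is monotone on nonnegative functions. [folklore] -/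
theorem mono_meanValue (B' : Finset (UT N)) {C : ℝ} (hC : 0 ≤ C) {Rd : ℝ} (hRd : 0 ≤ Rd) (z z' : UT N → ℝ)
    (hz : ∀ y, 0 ≤ z y) (h : ∀ y, z y ≤ z' y) :
    C * Real.sqrt ((∑ x ∈ B', z x ^ 2) / Rd) ≤ C * Real.sqrt ((∑ x ∈ B', z' x ^ 2) / Rd) :=
  mul_le_mul_of_nonneg_left (Real.sqrt_le_sqrt (div_le_div_of_nonneg_right
    (Finset.sum_le_sum fun x _ => pow_le_pow_left₀ (hz x) (h x) 2) hRd)) hC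

/-- **`hreg`'s SHAPE FOR `D*D` ON A TORUS BOX, WITH NO HYPOTHESIS LEFT.**  Unit torus (`d ≥ 1`), bonds `bsrc∕btgt`, constant weight
`c ≡ c₀ ≠ 0`, ANY column-orthonormal bond matrices `Rm`, centre `x₀`, radius `R ≥ 1` with `10R + 4 ≤ N_i`: for every field `f` with
`√(Σ_i ((D*Df)(x,i))²) ≤ m′` (`m′ ≥ 0`) on the ball `dist(·, x₀) ≤ R`,
`√(Σ_i f(x₀,i)²) ≤ C_d·√((Σ_{dist ≤ R} Σ_i f(x,i)²)/R^d) + m′·(R+1)²/(2c₀²)`.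
[cite: Balaban1985BackgroundPropagators, Thm 3.1 (3.42) p.397 + (3.23) p.394] [folklore] -/
theorem fibreNorm_le_box [NeZero d] {Cp : Type} [Fintype Cp] [DecidableEq Cp] {c : UT N × Fin d → ℝ} {c₀ : ℝ}
    (hc : ∀ b, c b = c₀) (hc₀ : c₀ ≠ 0) (Rm : UT N × Fin d → Cp → Cp → ℝ)
    (hRm : ∀ b i j, ∑ k, Rm b k i * Rm b k j = if i = j then (1 : ℝ) else 0) (f : UT N × Cp → ℝ)
    (x₀ : UT N) {R : ℕ} (hR : 1 ≤ R) (hN : ∀ i, 10 * R + 4 ≤ N i) {m' : ℝ} (hm' : 0 ≤ m')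
    (hsrc : ∀ x ∈ univ.filter (fun x : UT N => dist x x₀ ≤ R),
      Real.sqrt (∑ i, (covDT bsrc btgt c Rm (covD bsrc btgt c Rm f) (x, i)) ^ 2) ≤ m') :
    Real.sqrt (∑ i, f (x₀, i) ^ 2) ≤
      Cmv d * Real.sqrt ((∑ x ∈ univ.filter (fun x : UT N => dist x x₀ ≤ R), ∑ i, f (x, i) ^ 2) / (R : ℝ) ^ d) +
        m' * (((R : ℝ) + 1) ^ 2 / (2 * c₀ ^ 2)) := by
  have hd1 : 1 ≤ d := Nat.one_le_iff_ne_zero.mpr (NeZero.ne d)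
  have hr2 : ∀ μ, 2 * R + 2 ≤ N μ := fun μ => by have := hN μ; omega
  obtain ⟨w₀, h0, hle, hsup⟩ := exists_unit_supersolution_box hc hc₀ x₀ hr2
  have hC0 : 0 ≤ Cmv d := (Cmv_pos hd1).le
  have h := fibreNorm_le_meanValue bsrc btgt c Rm hRm f (univ.filter (fun x : UT N => dist x x₀ ≤ R)) x₀
    (fun z => Cmv d * Real.sqrt ((∑ x ∈ univ.filter (fun x : UT N => dist x x₀ ≤ R), z x ^ 2) / (R : ℝ) ^ d))
    (fun z z' hz hzz' => mono_meanValue _ hC0 (by positivity) z z' hz hzz')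
    (fun z hz0 hz => meanValue_ball hc hc₀ x₀ hR hN z hz0 hz) w₀ h0 hsup hm' hsrc
  have hsq : ∀ x, Real.sqrt (∑ i, f (x, i) ^ 2) ^ 2 = ∑ i, f (x, i) ^ 2 :=
    fun x => Real.sq_sqrt (Finset.sum_nonneg fun _ _ => sq_nonneg _)
  simp only [hsq] at h
  have h2 := mul_le_mul_of_nonneg_left (hle x₀) hm'
  linarith

end

end Summit.QuantumFields.BalabanUV.Beta.SubsolutionMeanValueBox
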